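import Mathlib.Topology.Bases
import Literature.AnabelianGeometry.SemiGraphs.TemperedExtensionTempered

/-!
# Extensions of tempered groups, III: Galois-countability (second countability) of the glued topology
# ([SemiAnbd] Rmk 3.1.2 p. 33; [IUTchI] Rmk 2.5.3 (i)/(ii) Galois-countable temperoids; Prop 5.2 (iv))

Mochizuki, *Semi-graphs of anabelioids*, Publ. RIMS **42** (2006) 221–322, Rmk 3.1.2 p. 33 ("every open
subgroup of `Π` is … of countable index"), Prop 5.2 (iii)/(iv) p. 64 (`Π^temp_𝔊 = π₁^temp(B^temp(𝔊))`)
[cite: MochizukiSemiAnbd2006, Prop 5.2 (iv), p. 64]; [IUTchI] Rmk 2.5.3 (i) (T6) "`π₁^temp(G)` and …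
`B^temp(G)` are well-defined and Galois-countable" (the `secondCountableTopology` field of
`TemperedPiChart`, `TemperedCoverings.lean`).

PROOF-ONLY sequel of `TemperedExtensionBasis.lean` / `TemperedExtensionTempered.lean` (row T54-B-top of
the producer debt T54-B, `HOME/plan/GAP-LEDGER.md` G-w4d053-1; seat abc-iut-L3-d2): the glued topology
on an extension `1 → Π → E → Π_A → 1` is SECOND COUNTABLE — so the arithmetic tempered group
`π₁^temp(𝒢) ⋊^out Π_A` is Galois-countable, as any `TemperedPiChart`-style package requires — as soon as
the basis is countable with countable-index members:

* `secondCountableTopology_of_subgroupBasis` — a topological group with a COUNTABLE basis of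
  neighbourhoods of `1` by subgroups of COUNTABLE index is second countable (the countably many left
  cosets form a topological basis);
* `secondCountableTopology_of_kernelSeq` — for the basis `{K n ⊓ aug⁻¹U}` of the kernel-sequence
  package: if `Π`, `Π_A` are tempered, `Π_A` is first countable at `1` (e.g. second countable), the
  traces `ι⁻¹(K n)` are open in `Π` and the images `aug(K n)` open in `Π_A`, then `E` is second
  countable (countable sub-basis `{K n ⊓ aug⁻¹(W m)}` along an antitone basis `W m` of `Π_A`;
  indices countable by `countable_quotient`).

Nothing here refers to the IUT corpus; no side is taken on any disputed claim.
-/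

namespace Literature.AnabelianGeometry.SemiGraphs

namespace TemperedExtension

open Topology Filter TopologicalSpace

universe u v w

section Countable

variable {E : Type w} [Group E] [TopologicalSpace E] [IsTopologicalGroup E]

omit [TopologicalSpace E] [IsTopologicalGroup E] in
/-- Left cosets as fibres of the projection: `{y | ȳ = x̄} = x · M`. [folklore] -/
private theorem fibre_eq_image (M : Subgroup E) (x : E) :
    {y : E | (y : E ⧸ M) = (x : E ⧸ M)} = (fun m => x * m) '' (M : Set E) := by
  ext y
  simp only [Set.mem_setOf_eq, Set.mem_image, SetLike.mem_coe]
  constructor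
  · intro h
    refine ⟨x⁻¹ * y, ?_, by rw [mul_inv_cancel_left]⟩
    have h' := (QuotientGroup.eq (s := M)).mp h.symm
    exact h'
  · rintro ⟨m, hm, rfl⟩
    rw [eq_comm, QuotientGroup.eq]
    simpa using hm

/-- **A topological group with a countable basis of neighbourhoods of `1` by subgroups of countable
index is second countable** (the left cosets of the basic subgroups form a countable topological basis;
[SemiAnbd] Rmk 3.1.2: open subgroups of a tempered group have countable index).
[cite: MochizukiSemiAnbd2006, Rmk 3.1.2, p. 33] -/
theorem secondCountableTopology_of_subgroupBasis {ι' : Type*} {p : ι' → Prop}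
    {s : ι' → Subgroup E} (hb : (𝓝 (1 : E)).HasBasis p (fun i => (s i : Set E)))
    (hcount : {i | p i}.Countable) (hidx : ∀ i, p i → Countable (E ⧸ s i)) :
    SecondCountableTopology E := by
  classical
  -- the family of left cosets of the basic subgroups
  let B : Set (Set E) := ⋃ i ∈ {i | p i}, Set.range (fun q : E ⧸ s i => {y : E | (y : E ⧸ s i) = q})
  have hBc : B.Countable := by
    refine hcount.biUnion fun i hi => ?_
    haveI := hidx i hi
    exact Set.countable_range _
  have hopen : ∀ i, p i → IsOpen (s i : Set E) := fun i hi =>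
    (s i).isOpen_of_mem_nhds (g := 1) (hb.mem_of_mem hi)
  have hB : IsTopologicalBasis B := by
    apply isTopologicalBasis_of_isOpen_of_nhds
    · intro u hu
      obtain ⟨i, hi, hu⟩ := Set.mem_iUnion₂.mp hu
      obtain ⟨q, rfl⟩ := hu
      obtain ⟨x, rfl⟩ := QuotientGroup.mk_surjective q
      change IsOpen {y : E | (y : E ⧸ s i) = (x : E ⧸ s i)}
      rw [fibre_eq_image]
      exact (Homeomorph.mulLeft x).isOpenMap _ (hopen i hi)
    · intro a u hau hu
      have h1 : (fun y => a * y) ⁻¹' u ∈ 𝓝 (1 : E) :=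
        (continuous_const_mul a).continuousAt.preimage_mem_nhds (by simpa using hu.mem_nhds hau)
      obtain ⟨i, hi, hiu⟩ := hb.mem_iff.mp h1
      refine ⟨{y : E | (y : E ⧸ s i) = (a : E ⧸ s i)}, ?_, rfl, ?_⟩
      · exact Set.mem_iUnion₂.mpr ⟨i, hi, (a : E ⧸ s i), rfl⟩
      · rw [fibre_eq_image]
        rintro _ ⟨m, hm, rfl⟩
        exact hiu hm
  exact hB.secondCountableTopology hBc

end Countable

/-! ### The kernel-sequence package is Galois-countable -/

section KernelSeq

variable {P : Type u} [Group P] [TopologicalSpace P]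
  {A : Type v} [Group A] [TopologicalSpace A] [IsTopologicalGroup A]
  {E : Type w} [Group E] [TopologicalSpace E] [IsTopologicalGroup E]
  (ι : P →* E) (aug : E →* A)

/-- **Galois-countability of the glued extension**: in the topology with basis `{K n ⊓ aug⁻¹U}`
(`exists_isTempered_topology_of_kernelSeq`), if `Π` and `Π_A` are tempered, `Π_A` is countably
generated at `1` (e.g. second countable, as every Galois-countable / topologically finitely generated
profinite group), the traces `ι⁻¹(K n)` are open in `Π` and the images `aug(K n)` open in `Π_A`, then
`E` is second countable. [cite: MochizukiSemiAnbd2006, Prop 5.2 (iv), p. 64] -/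
theorem secondCountableTopology_of_kernelSeq (K : ℕ → Subgroup E)
    (hb : (𝓝 (1 : E)).HasBasis (fun _ : ℕ × OpenNormalSubgroup A => True)
      (fun nU => ((K nU.1 ⊓ nU.2.toSubgroup.comap aug : Subgroup E) : Set E)))
    (hP : IsTempered P) (hA : IsTempered A) [(𝓝 (1 : A)).IsCountablyGenerated]
    (hex : ι.range = aug.ker) (hnormal : ∀ n, (K n).Normal)
    (hK1 : ∀ n, IsOpen (((K n).comap ι : Subgroup P) : Set P))
    (hK1' : ∀ n, IsOpen (((K n).map aug : Subgroup A) : Set A)) :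
    SecondCountableTopology E := by
  classical
  -- an antitone countable basis of open normal subgroups of `Π_A`
  obtain ⟨W, -, hW⟩ := hA.hasBasis_nhds_one.exists_antitone_subbasis
  have hWbasis : ∀ U ∈ 𝓝 (1 : A), ∃ m, (W m : Set A) ⊆ U := fun U hU => hW.mem_iff.mp hU
  -- the countable sub-basis `{K n ⊓ aug⁻¹ (W m)}`
  let s : ℕ × ℕ → Subgroup E := fun nm => K nm.1 ⊓ (W nm.2).toSubgroup.comap aug
  have hs : (𝓝 (1 : E)).HasBasis (fun _ : ℕ × ℕ => True) (fun nm => (s nm : Set E)) := by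
    refine ⟨fun S => ?_⟩
    rw [hb.mem_iff]
    constructor
    · rintro ⟨⟨n, U⟩, -, hS⟩
      obtain ⟨m, hm⟩ := hWbasis (U : Set A) U.toOpenSubgroup.mem_nhds_one
      refine ⟨(n, m), trivial, fun x hx => hS ?_⟩
      exact ⟨hx.1, hm hx.2⟩
    · rintro ⟨⟨n, m⟩, -, hS⟩
      exact ⟨(n, W m), trivial, hS⟩
  refine secondCountableTopology_of_subgroupBasis hs (Set.to_countable _) fun nm _ => ?_
  -- countable index of `K n ⊓ aug⁻¹ (W m)`
  haveI : (s nm).Normal := by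
    haveI := hnormal nm.1
    change (K nm.1 ⊓ (W nm.2).toSubgroup.comap aug).Normal
    infer_instance
  refine countable_quotient ι aug hex (s nm) ?_ ?_
  · -- the trace is `ι⁻¹(K n)`, open in the tempered `Π`
    have htrace : (s nm).comap ι = (K nm.1).comap ι := by
      ext p
      simp only [s, Subgroup.mem_comap, Subgroup.mem_inf]
      constructor
      · exact fun h => h.1
      · intro h
        refine ⟨h, ?_⟩
        change aug (ι p) ∈ (W nm.2).toSubgroup
        rw [aug_iota ι aug hex p]
        exact one_mem _
    rw [htrace]
    exact hP.countable_quotient _ (hK1 nm.1)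
  · -- the image is `aug(K n) ∩ W m`, open in the tempered `Π_A`
    have himage : (s nm).map aug = (K nm.1).map aug ⊓ (W nm.2).toSubgroup := by
      ext a
      simp only [s, Subgroup.mem_map, Subgroup.mem_inf, Subgroup.mem_comap]
      constructor
      · rintro ⟨k, ⟨hk, hkU⟩, rfl⟩
        exact ⟨⟨k, hk, rfl⟩, hkU⟩
      · rintro ⟨⟨k, hk, rfl⟩, hkU⟩
        exact ⟨k, ⟨hk, hkU⟩, rfl⟩
    rw [himage]
    apply hA.countable_quotient
    rw [Subgroup.coe_inf]
    exact (hK1' nm.1).inter (W nm.2).toOpenSubgroup.isOpen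

end KernelSeq

end TemperedExtension

end Literature.AnabelianGeometry.SemiGraphs
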